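import Literature.AnabelianGeometry.SemiGraphs.TemperedAnabelian
import Literature.NumberTheory.LocalFields.PadicAbsoluteGaloisGroupInfinite
import HarnessLib

/-!
# The Galois group `G_K` of a tempered curve's base field is an infinite compact group

PROOF-ONLY companion (abc-iut cell; seat abc-iut-w5-d119) of the `[SemiAnbd]` §6 interface
`Literature.AnabelianGeometry.SemiGraphs.TemperedCurve` (Mochizuki, *Semi-graphs of anabelioids*, §6
pp. 69–71: a hyperbolic curve `X_K` over a finite extension `K ⊆ K̄ = ℚ̄_p` of `ℚ_p`, with
`G_K = Gal(K̄/K)` realised as `K.fixingSubgroup ≤ Gal(ℚ̄_p/ℚ_p)` = the image of the augmentation,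
field `range_aug`) [cite: MochizukiSemiAnbd2006, §6 p.69].  For every `X : TemperedCurve p`:

* `TemperedCurve.infinite_galoisGroup` — `G_K = X.K.fixingSubgroup` is infinite;
* `TemperedCurve.compactSpace_galoisGroup` — it is compact;
* `TemperedCurve.infinite_GK` — the same for L3's name `X.GK`; `infinite_range_aug`, `infinite_piTemp`;
(`[T2Space Π^tp_X]` is already `TemperedCurve.t2Space_piTemp`, AbsTopIProp410DenseProofs.lean p417808.)

These are the `[CompactSpace G_k] [Infinite G_k]` binders of the `[IUTchI]` Cor. 2.5 kernel
`Literature.IUT.HodgeTheaters.StableCurveTemperedData.cor25_byName` at the genuine `G_K`; the arithmetic is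
`Literature.NumberTheory.LocalFields.Padic.infinite_fixingSubgroup` (`X ^ ℓ − p` irreducible over `ℚ_p`
for every prime `ℓ`, so `G_{ℚ_p}` is infinite; `G_K` is open in it).  No definition; nothing here bears on
[IUTchIII] Cor. 3.12.
-/

namespace Literature.AnabelianGeometry.SemiGraphs

namespace TemperedCurve

open Literature.NumberTheory.LocalFields

variable {p : ℕ} [Fact p.Prime] (X : TemperedCurve p)

/-- **`G_K` is infinite** for the base field `K` (finite over `ℚ_p`) of a tempered curve.
[cite: MochizukiSemiAnbd2006, §6 p.69] -/
theorem infinite_galoisGroup : Infinite X.K.fixingSubgroup := by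
  haveI := X.finiteDimensional_K
  exact Padic.infinite_fixingSubgroup p X.K

/-- **`G_K` is compact** (a closed subgroup of the profinite `G_{ℚ_p}`). [cite: MochizukiSemiAnbd2006, §6 p.69] -/
theorem compactSpace_galoisGroup : CompactSpace X.K.fixingSubgroup :=
  Padic.compactSpace_fixingSubgroup p X.K

/-- `G_K` under L3's name `TemperedCurve.GK`: infinite. [cite: MochizukiSemiAnbd2006, §6 p.69] -/
theorem infinite_GK : Infinite X.GK := X.infinite_galoisGroup

/-- … and compact. [cite: MochizukiSemiAnbd2006, §6 p.69] -/
theorem compactSpace_GK : CompactSpace X.GK := X.compactSpace_galoisGroup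

/-- The image of the tempered augmentation `Π^temp_{X_K} → G_{ℚ_p}` (which is `G_K`, field `range_aug`) is
infinite. [cite: MochizukiSemiAnbd2006, §6 p.69] -/
theorem infinite_range_aug : Infinite X.aug.toMonoidHom.range := by
  rw [X.range_aug]
  exact X.infinite_galoisGroup

/-- Hence the tempered fundamental group `Π^temp_{X_K}` itself is infinite. [cite: MochizukiSemiAnbd2006, §6 p.69] -/
theorem infinite_piTemp : Infinite X.PiTemp := by
  haveI := X.infinite_range_aug
  exact Infinite.of_surjective (fun g : X.PiTemp => (⟨X.aug.toMonoidHom g, ⟨g, rfl⟩⟩ : X.aug.toMonoidHom.range))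
    fun y => by obtain ⟨_, ⟨g, rfl⟩⟩ := y; exact ⟨g, rfl⟩

end TemperedCurve

end Literature.AnabelianGeometry.SemiGraphs
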